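import Literature.AlgebraicGeometry.Resolution.BlowupAlgebraPresentation
import Mathlib.Algebra.MvPolynomial.Equiv
import Mathlib.RingTheory.Polynomial.Quotient
import Mathlib.RingTheory.Localization.Away.Basic
import Mathlib.Tactic.Cases
import Mathlib.Tactic.Ring
import HarnessLib

/-!
# The affine blow-up chart of a regular pair: `R[b/a] ≅ R[X]/(aX − b)` (Stacks 0BIQ, `r = 2`)

Topic: `Literature/AlgebraicGeometry/Resolution`. The docstring of `BlowupChartQuasiRegular.lean`
records that the tree proves the chart of the blowing up of a quasi-regular sequence only MODULO
the exceptional divisor, and that "Stacks 0BIQ proves the finer statement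
`R[I/a] ≅ R[y_2, …, y_r]/(a y_j − a_j)` for `H₁`-regular sequences via Koszul complexes". This file
PROVES the finer statement for PAIRS by the elementary degree induction: for `a ∈ R` a
non-zero-divisor and `b` a non-zero-divisor modulo `a`, the kernel of the evaluation
`R[X] → R[1/a]`, `X ↦ b/a`, is the principal ideal `(aX − b)` (`BlowupChartPair.ker_chartEval`),
hence `R[b/a] ≅ R[X]/(aX − b)` (`BlowupChartPair.quotientEquivRange`; `R[b/a] = R[I/a]` for
`I = (a, b)` since `a/a = 1`). Proof: if `P(b/a) = 0` with `deg P ≤ n + 1`, clearing denominators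
(`a` regular) gives `Σ cᵢ bⁱ a^{n+1−i} = 0` in `R`, so `a ∣ c_{n+1} b^{n+1}`, so `a ∣ c_{n+1}`
(`b` regular mod `a`, iterated), and `P − c' Xⁿ (aX − b)` has smaller degree.

Application (cdisprove gen 5 on crux stmt-ResolutionOfSingularities-0642, §11 of
`Cruxes/PatchingRel/Disproof.lean`; `SandwichedBlowups.lean`): in `R = k[x₀, …, xₙ]` the pair
`(x₀ᵖ, g)` with `g ≠ 0` not involving `x₀` is regular (`BlowupChartPair.ker_chartEval_twistedPencil`,
via `k[x₀, …, xₙ] ≅ k[x₁, …, xₙ][Y]`), so the `x₀ᵖ`-chart of `Bl_{(x₀ᵖ, g)} 𝔸ⁿ⁺¹` is the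
hypersurface `x₀ᵖ T = g(x₁, …, xₙ)` — the Frobenius-twisted pencil of the `α_p`-torsor germ
`wᵖ = g` that the sandwiched-resolution statement must resolve strongly.

## References

* The Stacks Project, Tag 0BIQ (Lemma 15.32.2) and Tag 052P. [StacksProject]
-/

open Polynomial

namespace Literature.AlgebraicGeometry.Resolution

namespace BlowupChartPair

variable {R : Type*} [CommRing R]

/-- The evaluation `R[X] → R[1/a]`, `X ↦ b/a` (Stacks 052P: the affine blow-up algebra `R[I/a]`
is generated by the `x/a`, `x ∈ I`). [cite: StacksProject, Tag 052P] -/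
noncomputable def chartEval (a b : R) : R[X] →ₐ[R] Localization.Away a :=
  Polynomial.aeval (IsLocalization.mk' (Localization.Away a) b
    (⟨a, Submonoid.mem_powers a⟩ : Submonoid.powers a))

/-- Constants go to constants. [folklore] -/
theorem chartEval_C (a b c : R) : chartEval a b (C c) = algebraMap R _ c := by
  simp [chartEval]

/-- `(b/a) · a = b`. [folklore] -/
theorem chartEval_X_mul_a (a b : R) :
    chartEval a b X * algebraMap R (Localization.Away a) a = algebraMap R _ b := by
  simp only [chartEval, Polynomial.aeval_X]
  exact IsLocalization.mk'_spec (Localization.Away a) b ⟨a, _⟩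

/-- The relation `aX − b` dies in `R[1/a]`. [folklore] -/
theorem chartEval_rel (a b : R) : chartEval a b (C a * X - C b) = 0 := by
  rw [map_sub, map_mul, chartEval_C, chartEval_C, mul_comm, chartEval_X_mul_a, sub_self]

/-- Clearing denominators: `a ^ n * P(b/a) = Σᵢ cᵢ bⁱ a^(n-i)` for `natDegree P ≤ n`. [folklore] -/
theorem pow_mul_chartEval (a b : R) (P : R[X]) (n : ℕ) (hn : P.natDegree ≤ n) :
    algebraMap R (Localization.Away a) (a ^ n) * chartEval a b P =
      algebraMap R (Localization.Away a)
        (∑ i ∈ Finset.range (n + 1), P.coeff i * b ^ i * a ^ (n - i)) := by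
  classical
  set L := Localization.Away a
  set u : L := chartEval a b X with hu
  have hua : u * algebraMap R L a = algebraMap R L b := chartEval_X_mul_a a b
  have hP : chartEval a b P = ∑ i ∈ Finset.range (n + 1), algebraMap R L (P.coeff i) * u ^ i := by
    have e : chartEval a b P = Polynomial.aeval u P := by
      rw [hu]; simp [chartEval]
    rw [e, Polynomial.aeval_eq_sum_range' (Nat.lt_succ_of_le hn)]
    simp [Algebra.smul_def]
  rw [hP, Finset.mul_sum, map_sum]
  refine Finset.sum_congr rfl fun i hi => ?_
  have hi' : i ≤ n := Nat.lt_succ_iff.mp (Finset.mem_range.mp hi)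
  have key : algebraMap R L (a ^ n) * u ^ i = algebraMap R L (b ^ i * a ^ (n - i)) := by
    have : a ^ n = a ^ i * a ^ (n - i) := by rw [← pow_add, Nat.add_sub_cancel' hi']
    rw [this, map_mul, map_mul, map_pow, map_pow, map_pow]
    have h2 : algebraMap R L a ^ i * u ^ i = algebraMap R L b ^ i := by
      rw [← mul_pow, mul_comm, hua]
    calc algebraMap R L a ^ i * algebraMap R L a ^ (n - i) * u ^ i
        = (algebraMap R L a ^ i * u ^ i) * algebraMap R L a ^ (n - i) := by ring
      _ = algebraMap R L b ^ i * algebraMap R L a ^ (n - i) := by rw [h2]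
  calc algebraMap R L (a ^ n) * (algebraMap R L (P.coeff i) * u ^ i)
      = algebraMap R L (P.coeff i) * (algebraMap R L (a ^ n) * u ^ i) := by ring
    _ = algebraMap R L (P.coeff i * b ^ i * a ^ (n - i)) := by
        rw [key, ← map_mul, mul_assoc]

/-- `b` regular modulo `a`, iterated on powers of `b`. [folklore] -/
theorem dvd_of_dvd_mul_pow {a b : R} (hb : ∀ r : R, a ∣ r * b → a ∣ r) (m : ℕ) (r : R)
    (h : a ∣ r * b ^ m) : a ∣ r := by
  induction' m with m ih generalizing r
  · simpa using h
  · apply ih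
    apply hb
    rwa [mul_assoc, ← pow_succ]

/-- **The kernel of the chart evaluation is `(aX - b)`** for `a` a non-zero-divisor and `b` a
non-zero-divisor modulo `a` (Stacks 0BIQ = Lemma 15.32.2 for the `H₁`-regular sequence `(a, b)`:
"`R[I/a] ≅ R[y]/(a y − b)`"; proved here by degree induction instead of Koszul homology).
[cite: StacksProject, Tag 0BIQ] -/
theorem ker_chartEval (a b : R) (ha : a ∈ nonZeroDivisors R)
    (hb : ∀ r : R, a ∣ r * b → a ∣ r) :
    RingHom.ker (chartEval a b).toRingHom = Ideal.span {C a * X - C b} := by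
  classical
  set L := Localization.Away a
  have hinj : Function.Injective (algebraMap R L) :=
    IsLocalization.injective L ((Submonoid.powers_le (P := nonZeroDivisors R)).mpr ha)
  apply le_antisymm
  · suffices h : ∀ n : ℕ, ∀ P : R[X], P.natDegree ≤ n → chartEval a b P = 0 →
        P ∈ Ideal.span {C a * X - C b} by
      intro P hP
      exact h _ P le_rfl (by simpa [RingHom.mem_ker] using hP)
    intro n
    induction' n with n ih
    · intro P hdeg hP
      have hPC : P = C (P.coeff 0) := Polynomial.eq_C_of_natDegree_le_zero hdeg
      rw [hPC, chartEval_C] at hP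
      have hc : P.coeff 0 = 0 := hinj (by rw [hP, map_zero])
      rw [hPC, hc, map_zero]
      exact Ideal.zero_mem _
    · intro P hdeg hP
      -- clear denominators
      have hsum : ∑ i ∈ Finset.range (n + 2), P.coeff i * b ^ i * a ^ (n + 1 - i) = 0 := by
        apply hinj
        rw [map_zero, ← pow_mul_chartEval a b P (n + 1) hdeg, hP, mul_zero]
      -- modulo `a`: `a ∣ c_{n+1} b^{n+1}`
      have hdvd : a ∣ P.coeff (n + 1) * b ^ (n + 1) := by
        rw [Finset.sum_range_succ, Nat.sub_self, pow_zero, mul_one] at hsum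
        have e : P.coeff (n + 1) * b ^ (n + 1) =
            -∑ i ∈ Finset.range (n + 1), P.coeff i * b ^ i * a ^ (n + 1 - i) :=
          eq_neg_of_add_eq_zero_right hsum
        rw [e]
        refine (Finset.dvd_sum fun i hi => ?_).neg_right
        have hi' : i ≤ n := Nat.lt_succ_iff.mp (Finset.mem_range.mp hi)
        have : n + 1 - i = (n - i) + 1 := by omega
        rw [this, pow_succ]
        exact ⟨P.coeff i * b ^ i * a ^ (n - i), by ring⟩
      obtain ⟨c', hc'⟩ := dvd_of_dvd_mul_pow hb (n + 1) _ hdvd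
      -- subtract `c' X^n (aX - b)`
      set Q : R[X] := P - C c' * X ^ n * (C a * X - C b) with hQdef
      have hQ : chartEval a b Q = 0 := by
        rw [hQdef, map_sub, map_mul, chartEval_rel, mul_zero, sub_zero, hP]
      have hexp : C c' * X ^ n * (C a * X - C b) = C (c' * a) * X ^ (n + 1) - C (c' * b) * X ^ n := by
        simp only [map_mul, pow_succ]
        ring
      have hQdeg : Q.natDegree ≤ n := by
        rw [Polynomial.natDegree_le_iff_coeff_eq_zero]
        intro m hm
        rw [hQdef, hexp, coeff_sub, coeff_sub, coeff_C_mul_X_pow, coeff_C_mul_X_pow]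
        have hmn : m ≠ n := by omega
        rw [if_neg hmn, sub_zero]
        by_cases hm1 : m = n + 1
        · subst hm1
          rw [if_pos rfl, hc', mul_comm, sub_self]
        · rw [if_neg hm1, sub_zero]
          apply Polynomial.coeff_eq_zero_of_natDegree_lt
          omega
      have hQmem := ih Q hQdeg hQ
      have hmem : C c' * X ^ n * (C a * X - C b) ∈ Ideal.span {C a * X - C b} :=
        Ideal.mul_mem_left _ _ (Ideal.subset_span rfl)
      have hPQ : P = Q + C c' * X ^ n * (C a * X - C b) := by rw [hQdef]; ring
      rw [hPQ]
      exact Ideal.add_mem _ hQmem hmem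
  · rw [Ideal.span_le, Set.singleton_subset_iff, SetLike.mem_coe, RingHom.mem_ker]
    exact chartEval_rel a b

end BlowupChartPair

end Literature.AlgebraicGeometry.Resolution

namespace Literature.AlgebraicGeometry.Resolution

namespace BlowupChartPair

open Polynomial

variable {R : Type*} [CommRing R]

/-- `R[b/a] ≅ R[X]/(aX - b)` for a regular pair: the range of the chart evaluation is the quotient.
[cite: StacksProject, Tag 0BIQ] -/
noncomputable def quotientEquivRange (a b : R) (ha : a ∈ nonZeroDivisors R)
    (hb : ∀ r : R, a ∣ r * b → a ∣ r) :
    (R[X] ⧸ Ideal.span {C a * X - C b}) ≃+* (chartEval a b).toRingHom.range :=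
  (Ideal.quotEquivOfEq (ker_chartEval a b ha hb).symm).trans
    (RingHom.quotientKerEquivRange (chartEval a b).toRingHom)

/-- In a polynomial ring `S[Y]` over a domain, `Y^p ∣ r · C g₀` with `g₀ ≠ 0` forces `Y^p ∣ r`.
[folklore] -/
theorem X_pow_dvd_of_dvd_mul_C {S : Type*} [CommRing S] [IsDomain S] {g₀ : S} (hg : g₀ ≠ 0)
    (p : ℕ) (r : S[X]) (h : (X : S[X]) ^ p ∣ r * C g₀) : (X : S[X]) ^ p ∣ r := by
  rw [Polynomial.X_pow_dvd_iff] at h ⊢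
  intro d hd
  have := h d hd
  rw [Polynomial.coeff_mul_C] at this
  exact (mul_eq_zero.mp this).resolve_right hg

/-- **The twisted-pencil chart.** In `R = k[x₀, …, xₙ]` let `a` correspond to `Y ^ p` and `b` to
`C g₀` under `R ≃ k[x₁, …, xₙ][Y]` (`MvPolynomial.finSuccEquiv`, `x₀ ↦ Y`), with `g₀ ≠ 0` — i.e.
`a = x₀ ^ p` and `b = g` a non-zero polynomial not involving `x₀`. Then `(a, b)` is a regular pair,
so `R[g/x₀ᵖ] ≅ R[T]/(x₀ᵖ T - g)`: the `x₀ᵖ`-chart of the blow-up of `𝔸ⁿ⁺¹` along `(x₀ᵖ, g)` is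
the hypersurface `x₀ᵖ T = g(x₁, …, xₙ)`. [cite: StacksProject, Tag 0BIQ (instance)] -/
theorem ker_chartEval_twistedPencil (k : Type*) [Field k] (n p : ℕ) (g₀ : MvPolynomial (Fin n) k)
    (hg : g₀ ≠ 0) (a b : MvPolynomial (Fin (n + 1)) k)
    (ha : MvPolynomial.finSuccEquiv k n a = Polynomial.X ^ p)
    (hb : MvPolynomial.finSuccEquiv k n b = Polynomial.C g₀) :
    RingHom.ker (chartEval a b).toRingHom = Ideal.span {C a * X - C b} := by
  apply ker_chartEval
  · apply mem_nonZeroDivisors_of_ne_zero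
    intro h0
    have hX : (Polynomial.X : Polynomial (MvPolynomial (Fin n) k)) ^ p = 0 := by
      rw [← ha, h0, map_zero]
    exact pow_ne_zero p Polynomial.X_ne_zero hX
  · intro r h
    obtain ⟨c, hc⟩ := h
    have h1 : (Polynomial.X : Polynomial (MvPolynomial (Fin n) k)) ^ p ∣
        MvPolynomial.finSuccEquiv k n r * Polynomial.C g₀ := by
      refine ⟨MvPolynomial.finSuccEquiv k n c, ?_⟩
      rw [← hb, ← map_mul, hc, map_mul, ha]
    obtain ⟨d, hd⟩ := X_pow_dvd_of_dvd_mul_C hg p _ h1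
    refine ⟨(MvPolynomial.finSuccEquiv k n).symm d, ?_⟩
    apply (MvPolynomial.finSuccEquiv k n).injective
    rw [map_mul, ha, AlgEquiv.apply_symm_apply, ← hd]

/-- The hypotheses of `ker_chartEval_twistedPencil` are met by `a = x₀ ^ p`, `b = e⁻¹ (C g₀)`.
[folklore] -/
theorem finSuccEquiv_X_zero_pow (k : Type*) [Field k] (n p : ℕ) :
    MvPolynomial.finSuccEquiv k n (MvPolynomial.X 0 ^ p) = Polynomial.X ^ p := by
  rw [map_pow, MvPolynomial.finSuccEquiv_X_zero]

end BlowupChartPair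

end Literature.AlgebraicGeometry.Resolution
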